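import Summits.QuantumFields.QCD.Theorems.QuarksAsStableActionCriticalLineDiamagnetismRectFreqOpStatic
import Summits.QuantumFields.QCD.Theorems.QuarksAsStableActionCriticalLineDiamagnetismRectFreqOpTransfer
import Summits.QuantumFields.QCD.Theorems.QuarksAsStableActionCriticalLineDiamagnetismRectFreqOpTranspose
import Summits.QuantumFields.QCD.Theorems.QuarksAsStableActionCriticalLineDiamagnetismPressure
import Summits.QuantumFields.QCD.Theorems.QuarksAsStableActionCriticalLineDiamagnetismStaticPressureOdd
import Summits.QuantumFields.QCD.Theorems.QuarksAsStableActionCriticalLineDiamagnetismFreeGap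
import Summits.QuantumFields.QCD.Theorems.QuarksAsStableActionCriticalLineDiamagnetismCellGaugeFix
import Summits.QuantumFields.QCD.Theorems.QuarksAsStableActionCriticalLineDiamagnetismHeavyInvertible
import Summits.QuantumFields.QCD.Theorems.QuarksAsStableActionCriticalLineDiamagnetismStaticPressureEven
import Summits.QuantumFields.QCD.Theorems.QuarksAsStableActionCriticalLineDiamagnetismReflectionChain
import Summits.QuantumFields.QCD.Theorems.QuarksAsStableActionCriticalLineDiamagnetismCellSecondOrderAux4
import Summits.QuantumFields.QCD.Theorems.QuarksAsStableActionCriticalLineDiamagnetismCellLemma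
import Summits.QuantumFields.QCD.Theorems.QuarksAsStableActionCriticalLineDiamagnetismCellKappaCert
import Summits.QuantumFields.QCD.Theorems.QuarksAsStableActionCriticalLineDiamagnetismCellKappaDefs
import Mathlib.Analysis.SpecialFunctions.Log.Basic

/-!
# S4 `stub_heavyFrequencyGain`, auxiliary file — the pieces of the Route-B assembly (crux `stmt-QuantumFields-9734`, line `Sketch`)

Sub-problem context: `Summits/QuantumFields/QCD/Statement.lean`; crux decl
`Summit.QuantumFields.QCD.Theses.QuarksAsStableAction.CriticalLineDiamagnetism`; this file closes the registered stub
`stub_heavyFrequencyGain` of the line skeleton (`Cruxes/CriticalLineDiamagnetism/Lines/Sketch.lean`, static route S4).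

ROUTE B (reflection positivity in frequency land): per heavy frequency on the odd torus `(ℤ/L)²`, `L = 2n+1`:
rows — `reflectionChain` + `staticPressureOdd` (averaged over the reflection row); columns of every slab pattern — transpose +
`reflectionChain` + `staticPressureEven`; cells — `cellGaugeFix` + `cellLemma` (B6, with the certified `CellKappaClaim`); free
side — `freeGap` twice with the free `(2n)×L` determinant as pivot; double averaging.  Pure theorem file.  References: Lüscher,
Commun. Math. Phys. 54 (1977) 283; Osterwalder–Seiler, Ann. Phys. 110 (1978) 440; Fröhlich–Israel–Lieb–Simon, Commun. Math. Phys.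
62 (1978) 1; Salmhofer–Seiler, Commun. Math. Phys. 139 (1991) 395.  Plan: lead folder `work/odd/S4-PLAN.md`.
-/
noncomputable section
open scoped BigOperators Matrix ComplexOrder
open Matrix Literature.MathematicalPhysics.QuantumLattice
open Summit.QuantumFields.QCD.Cruxes.CriticalLineDiamagnetism.ChessboardCellGain.FrequencyDiamagnetism
open Summit.QuantumFields.QCD.Cruxes.CriticalLineDiamagnetism.ChessboardCellGain.CellKappa

namespace Summit.QuantumFields.QCD.Cruxes.CriticalLineDiamagnetism.ChessboardCellGain

open Cell

/-! ### Generic helpers -/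

namespace HeavyGain

/-- Pressures of equal matrices agree (the `PosDef` proofs are irrelevant). -/
theorem pressure_congr {k : Type} [Fintype k] [DecidableEq k] {M M' : Matrix k k ℂ} (h : M = M')
    (hM : M.PosDef) (hM' : M'.PosDef) :
    ∑ i, Real.log (max (hM.1.eigenvalues i) 1) = ∑ i, Real.log (max (hM'.1.eigenvalues i) 1) := by
  subst h; rfl

/-- Lower pressure bound: `N · p(M) ≤ log det(1 + M^N)` (and the determinant is real positive). -/
theorem pressure_le_log_det {k : Type} [Fintype k] [DecidableEq k] (M : Matrix k k ℂ) (hM : M.PosDef) (N : ℕ) :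
    0 < ((1 + M ^ N).det).re ∧
      (N : ℝ) * ∑ i, Real.log (max (hM.1.eigenvalues i) 1) ≤ Real.log ((1 + M ^ N).det).re := by
  have hdet := det_one_add_pow_eq M hM.posSemidef N
  have hre : ((1 + M ^ N).det).re = ∏ i, (1 + hM.1.eigenvalues i ^ N) := by
    rw [hdet, ← Complex.ofReal_prod, Complex.ofReal_re]
  have hpos : ∀ i, 0 < 1 + hM.1.eigenvalues i ^ N := fun i =>
    add_pos_of_pos_of_nonneg one_pos (pow_nonneg (hM.eigenvalues_pos i).le N)
  refine ⟨by rw [hre]; exact Finset.prod_pos fun i _ => hpos i, ?_⟩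
  rw [hre, Real.log_prod (fun i _ => (hpos i).ne'), Finset.mul_sum]
  exact Finset.sum_le_sum fun i _ => (log_one_add_pow_bounds (hM.eigenvalues_pos i).le N).1

/-- `log (a^N · X) = N log a + log X` for `a ≠ 0`, `X > 0`. -/
theorem log_pow_mul {a X : ℝ} (ha : a ≠ 0) (hX : 0 < X) (N : ℕ) :
    Real.log (a ^ N * X) = N * Real.log a + Real.log X := by
  rw [Real.log_mul (pow_ne_zero N ha) hX.ne', Real.log_pow]

/-! ### The free side -/

/-- The static field read on row `s` of the free field is the free field (as far as `freqOpR g` is concerned). -/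
theorem freqOpR_static_free {L₁ L₂ : ℕ} [NeZero L₁] [NeZero L₂] (g : Fin 4 → Matrix (Fin 4) (Fin 4) ℂ) (m ω₀ ω₁ : ℝ)
    (s : ZMod L₁) :
    freqOpR g (fun (_ : ZMod L₁) (x : ZMod L₂) (μ : Fin 4) =>
        if μ = 3 then (fun (_ : ZMod L₁) (_ : ZMod L₂) (_ : Fin 4) => (1 : Matrix.unitaryGroup (Fin 3) ℂ)) s x 3 else 1) m ω₀ ω₁ =
      freqOpR g (fun (_ : ZMod L₁) (_ : ZMod L₂) (_ : Fin 4) => (1 : Matrix.unitaryGroup (Fin 3) ℂ)) m ω₀ ω₁ :=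
  freqOpR_congr_links _ m ω₀ ω₁ g _ (fun _ _ => by simp) (fun _ _ => by simp)

/-- The free determinant on `ℤ/L₁ × ℤ/L₂` in static form: `log ‖det D_free‖ = L₁ log e_f + log det(1 + M_f^{L₁})`, the free
row objects `e_f`, `M_f` being read on the one-row lattice `ℤ/1 × ℤ/L₂`. -/
theorem log_norm_det_free (L₁ L₂ : ℕ) [NeZero L₁] [NeZero L₂] {m : ℝ} (hm : |m| ≤ 1 / 10) {ω₀ ω₁ : ℝ}
    (h0 : Real.cos ω₀ ≤ -(199 / 200)) (h1 : Real.cos ω₁ ≤ -(199 / 200))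
    (hM : (oneStepR (fun (_ : ZMod 1) (_ : ZMod L₂) (_ : Fin 4) => (1 : Matrix.unitaryGroup (Fin 3) ℂ)) m ω₀ ω₁ 0).PosDef) :
    ‖(sliceOpR (fun (_ : ZMod 1) (_ : ZMod L₂) (_ : Fin 4) => (1 : Matrix.unitaryGroup (Fin 3) ℂ)) m ω₀ ω₁ 0 * projM L₂ - projP L₂).det‖ ≠ 0 ∧
    0 < ((1 + oneStepR (fun (_ : ZMod 1) (_ : ZMod L₂) (_ : Fin 4) => (1 : Matrix.unitaryGroup (Fin 3) ℂ)) m ω₀ ω₁ 0 ^ L₁).det).re ∧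
    Real.log ‖(freqOpR euclideanGamma (fun (_ : ZMod L₁) (_ : ZMod L₂) (_ : Fin 4) => (1 : Matrix.unitaryGroup (Fin 3) ℂ)) m ω₀ ω₁).det‖ =
      L₁ * Real.log ‖(sliceOpR (fun (_ : ZMod 1) (_ : ZMod L₂) (_ : Fin 4) => (1 : Matrix.unitaryGroup (Fin 3) ℂ)) m ω₀ ω₁ 0 * projM L₂ - projP L₂).det‖ +
        Real.log ((1 + oneStepR (fun (_ : ZMod 1) (_ : ZMod L₂) (_ : Fin 4) => (1 : Matrix.unitaryGroup (Fin 3) ℂ)) m ω₀ ω₁ 0 ^ L₁).det).re := by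
  have hm1 : -1 < m := by have := (abs_le.mp hm).1; linarith
  set F : ZMod L₁ → ZMod L₂ → Fin 4 → Matrix.unitaryGroup (Fin 3) ℂ := fun _ _ _ => 1 with hF
  set F1 : ZMod 1 → ZMod L₂ → Fin 4 → Matrix.unitaryGroup (Fin 3) ℂ := fun _ _ _ => 1 with hF1
  -- static form of the free determinant
  have hstat := rectNormDetStatic F hm1 ω₀ ω₁ 0
  have hfield : tfreqOpR (fun (_ : ZMod L₁) (x : ZMod L₂) (μ : Fin 4) => if μ = 3 then F 0 x 3 else 1) m ω₀ ω₁ =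
      tfreqOpR F m ω₀ ω₁ := freqOpR_static_free _ m ω₀ ω₁ 0
  rw [hfield, det_tfreqOpR] at hstat
  have hsl : sliceOpR F m ω₀ ω₁ 0 = sliceOpR F1 m ω₀ ω₁ 0 := sliceOpR_congr F1 F m ω₀ ω₁ 0 0 (fun _ => rfl)
  have hos : oneStepR F m ω₀ ω₁ 0 = oneStepR F1 m ω₀ ω₁ 0 := oneStepR_congr F1 F m ω₀ ω₁ 0 0 (fun _ => rfl)
  rw [hsl, hos] at hstat
  have hX := (pressure_le_log_det _ hM L₁).1
  have hne : ‖(freqOpR euclideanGamma F m ω₀ ω₁).det‖ ≠ 0 :=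
    norm_ne_zero_iff.mpr (heavyInvertible L₁ L₂ F m hm ω₀ ω₁ h0 h1).ne_zero
  have he : ‖(sliceOpR F1 m ω₀ ω₁ 0 * projM L₂ - projP L₂).det‖ ≠ 0 := by
    intro h0'
    rw [h0', zero_pow (NeZero.ne L₁), zero_mul] at hstat
    exact hne hstat
  exact ⟨he, hX, by rw [hstat, log_pow_mul he hX]⟩

/-- **Free side.**  With `π(K) = log e_f(K) + p(M_f(K))` the free static pressure of a row of length `K`:
`π(L) + π(2n) + log ‖det D_free^{2n×2n}‖ ≤ log ‖det D_free^{L×L}‖ + 12(2n)(1/4)^{2n} + 12 L (1/4)^{2n}`, `L = 2n+1`. -/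
theorem freeSide (n : ℕ) [NeZero n] {m : ℝ} (hm : |m| ≤ 1 / 10) {ω₀ ω₁ : ℝ}
    (h0 : Real.cos ω₀ ≤ -(199 / 200)) (h1 : Real.cos ω₁ ≤ -(199 / 200))
    (hL : (oneStepR (fun (_ : ZMod 1) (_ : ZMod (2 * n + 1)) (_ : Fin 4) => (1 : Matrix.unitaryGroup (Fin 3) ℂ)) m ω₀ ω₁ 0).PosDef)
    (h2n : (oneStepR (fun (_ : ZMod 1) (_ : ZMod (2 * n)) (_ : Fin 4) => (1 : Matrix.unitaryGroup (Fin 3) ℂ)) m ω₀ ω₁ 0).PosDef) :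
    (Real.log ‖(sliceOpR (fun (_ : ZMod 1) (_ : ZMod (2 * n + 1)) (_ : Fin 4) => (1 : Matrix.unitaryGroup (Fin 3) ℂ)) m ω₀ ω₁ 0 *
          projM (2 * n + 1) - projP (2 * n + 1)).det‖ + ∑ i, Real.log (max (hL.1.eigenvalues i) 1)) +
    (Real.log ‖(sliceOpR (fun (_ : ZMod 1) (_ : ZMod (2 * n)) (_ : Fin 4) => (1 : Matrix.unitaryGroup (Fin 3) ℂ)) m ω₀ ω₁ 0 *
          projM (2 * n) - projP (2 * n)).det‖ + ∑ i, Real.log (max (h2n.1.eigenvalues i) 1)) +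
    Real.log ‖(freqOpR euclideanGamma (fun (_ _ : ZMod (2 * n)) (_ : Fin 4) => (1 : Matrix.unitaryGroup (Fin 3) ℂ)) m ω₀ ω₁).det‖ ≤
    Real.log ‖(freqOpR euclideanGamma (fun (_ _ : ZMod (2 * n + 1)) (_ : Fin 4) => (1 : Matrix.unitaryGroup (Fin 3) ℂ)) m ω₀ ω₁).det‖ +
      12 * (2 * n : ℝ) * (1 / 4 : ℝ) ^ (2 * n) + 12 * (2 * n + 1 : ℝ) * (1 / 4 : ℝ) ^ (2 * n) := by
  have hn : 0 < 2 * n := Nat.pos_of_ne_zero (NeZero.ne _)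
  -- the four free determinants in static form
  obtain ⟨_, _, hF2n⟩ := log_norm_det_free (2 * n) (2 * n) hm h0 h1 h2n
  obtain ⟨_, _, hF1⟩ := log_norm_det_free (2 * n + 1) (2 * n) hm h0 h1 h2n
  obtain ⟨_, _, hF1'⟩ := log_norm_det_free (2 * n) (2 * n + 1) hm h0 h1 hL
  obtain ⟨_, _, hFL⟩ := log_norm_det_free (2 * n + 1) (2 * n + 1) hm h0 h1 hL
  -- the transpose identity `det D_free^{L×2n} = det D_free^{2n×L}`
  have htr : (freqOpR euclideanGamma (fun (_ : ZMod (2 * n + 1)) (_ : ZMod (2 * n)) (_ : Fin 4) =>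
      (1 : Matrix.unitaryGroup (Fin 3) ℂ)) m ω₀ ω₁).det =
      (freqOpR euclideanGamma (fun (_ : ZMod (2 * n)) (_ : ZMod (2 * n + 1)) (_ : Fin 4) =>
      (1 : Matrix.unitaryGroup (Fin 3) ℂ)) m ω₀ ω₁).det :=
    (rectDetTranspose (2 * n) (2 * n + 1) (fun _ _ _ => 1) m ω₀ ω₁).symm
  -- gap bounds (upper) and pressure bounds (lower)
  have hg1 := freeGap (2 * n) m hm ω₀ ω₁ h0 h1 (2 * n) hn h2n
  have hg2 := freeGap (2 * n + 1) m hm ω₀ ω₁ h0 h1 (2 * n) hn hL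
  have hp1 := (pressure_le_log_det _ h2n (2 * n + 1)).2
  have hp2 := (pressure_le_log_det _ hL (2 * n + 1)).2
  rw [htr] at hF1
  push_cast at *
  nlinarith [hF2n, hF1, hF1', hFL, hg1, hg2, hp1, hp2]


/-! ### Averaging over the reflection row -/

/-- If for every reflection row `r` we have `X ≤ π + (1/2n) Σ_{s ≠ r+n} B s`, then `X ≤ π + (1/(2n+1)) Σ_s B s`. -/
theorem average_rows : ∀ (n : ℕ) [NeZero n] (X π : ℝ) (B : ZMod (2 * n + 1) → ℝ),
    (∀ r : ZMod (2 * n + 1), X ≤ π + (1 / (2 * n : ℝ)) * ∑ s ∈ Finset.univ.erase (r + n), B s) →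
    X ≤ π + (1 / (2 * n + 1 : ℝ)) * ∑ s, B s := by
  intro n _ X π B h
  have hn : (0 : ℝ) < n := Nat.cast_pos.mpr (Nat.pos_of_ne_zero (NeZero.ne n))
  have hsum := Finset.sum_le_sum fun r (_ : r ∈ (Finset.univ : Finset (ZMod (2 * n + 1)))) => h r
  have herase : ∀ r : ZMod (2 * n + 1), ∑ s ∈ Finset.univ.erase (r + n), B s = ∑ s, B s - B (r + n) := fun r =>
    Finset.sum_erase_eq_sub (Finset.mem_univ _)
  simp only [herase, Finset.sum_const, Finset.card_univ, ZMod.card, nsmul_eq_mul] at hsum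
  rw [Finset.sum_add_distrib, Finset.sum_const, Finset.card_univ, ZMod.card, nsmul_eq_mul, ← Finset.mul_sum,
    Finset.sum_sub_distrib, Finset.sum_const, Finset.card_univ, ZMod.card, nsmul_eq_mul] at hsum
  have hshift : ∑ r : ZMod (2 * n + 1), B (r + n) = ∑ r, B r :=
    Fintype.sum_equiv (Equiv.addRight (n : ZMod (2 * n + 1))) _ _ fun _ => rfl
  rw [hshift] at hsum
  push_cast at hsum
  -- hsum : (2n+1) X ≤ (2n+1) π + (1/(2n)) ((2n+1) Σ B − Σ B)
  rw [show (2 * (n : ℝ) + 1) * ∑ r, B r - ∑ r, B r = 2 * n * ∑ r, B r by ring] at hsum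
  have h2 : (1 / (2 * n : ℝ)) * (2 * n * ∑ r, B r) = ∑ r, B r := by field_simp
  rw [h2] at hsum
  have hL : (0 : ℝ) < 2 * n + 1 := by linarith
  rw [← sub_nonneg] at hsum ⊢
  have : π + 1 / (2 * n + 1 : ℝ) * ∑ s, B s - X = ((2 * n + 1) * π + ∑ r, B r - (2 * n + 1) * X) / (2 * n + 1) := by
    field_simp
  rw [this]
  exact div_nonneg (by linarith) hL.le


/-! ### Chain 1: rows -/

/-- Row pressures are at most the free pressure (odd slice length), in the form `reflectionChain` wants. -/
theorem rowPressure_le (n : ℕ) [NeZero n] {L₁ : ℕ} [NeZero L₁]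
    (A : ZMod L₁ → ZMod (2 * n + 1) → Fin 4 → Matrix.unitaryGroup (Fin 3) ℂ) {m : ℝ} (hm : |m| ≤ 1 / 10) (ω₀ ω₁ : ℝ)
    (hL : (oneStepR (fun (_ : ZMod 1) (_ : ZMod (2 * n + 1)) (_ : Fin 4) => (1 : Matrix.unitaryGroup (Fin 3) ℂ)) m ω₀ ω₁ 0).PosDef)
    (s : ZMod L₁) (hs : (oneStepR A m ω₀ ω₁ s).PosDef) :
    Real.log ‖(sliceOpR A m ω₀ ω₁ s * projM (2 * n + 1) - projP (2 * n + 1)).det‖ + ∑ i, Real.log (max (hs.1.eigenvalues i) 1) ≤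
      Real.log ‖(sliceOpR (fun (_ : ZMod 1) (_ : ZMod (2 * n + 1)) (_ : Fin 4) => (1 : Matrix.unitaryGroup (Fin 3) ℂ)) m ω₀ ω₁ 0 *
          projM (2 * n + 1) - projP (2 * n + 1)).det‖ + ∑ i, Real.log (max (hL.1.eigenvalues i) 1) := by
  have hm1 : -1 < m := by have := (abs_le.mp hm).1; linarith
  have hodd : Odd (2 * n + 1) := odd_two_mul_add_one n
  have h3 : ∀ x, (fun (_ : ZMod 1) (x : ZMod (2 * n + 1)) (μ : Fin 4) => if μ = 3 then A s x 3 else 1) 0 x 3 = A s x 3 :=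
    fun x => if_pos rfl
  have hsl := sliceOpR_congr A (fun (_ : ZMod 1) (x : ZMod (2 * n + 1)) (μ : Fin 4) => if μ = 3 then A s x 3 else 1)
    m ω₀ ω₁ 0 s h3
  have hos := oneStepR_congr A (fun (_ : ZMod 1) (x : ZMod (2 * n + 1)) (μ : Fin 4) => if μ = 3 then A s x 3 else 1)
    m ω₀ ω₁ 0 s h3
  have hr : (oneStepR (fun (_ : ZMod 1) (x : ZMod (2 * n + 1)) (μ : Fin 4) => if μ = 3 then A s x 3 else 1) m ω₀ ω₁ 0).PosDef := by
    rw [hos]; exact hs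
  have key := staticPressureOdd (2 * n + 1) hodd (fun x => A s x 3) m hm1 ω₀ ω₁ hr hL
  rw [hsl, pressure_congr hos hr hs] at key
  exact key

/-- **Chain 1** (rows, averaged over the reflection row): `log ‖det D_A‖ ≤ π_f(L) + (1/L) Σ_s log ‖det D_{pat_s}‖`. -/
theorem chain1 (n : ℕ) [NeZero n] (A : ZMod (2 * n + 1) → ZMod (2 * n + 1) → Fin 4 → Matrix.unitaryGroup (Fin 3) ℂ)
    {m : ℝ} (hm : |m| ≤ 1 / 10) (ω₀ ω₁ : ℝ)
    (hL : (oneStepR (fun (_ : ZMod 1) (_ : ZMod (2 * n + 1)) (_ : Fin 4) => (1 : Matrix.unitaryGroup (Fin 3) ℂ)) m ω₀ ω₁ 0).PosDef)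
    (hA : (tfreqOpR A m ω₀ ω₁).det ≠ 0) :
    Real.log ‖(tfreqOpR A m ω₀ ω₁).det‖ ≤
      (Real.log ‖(sliceOpR (fun (_ : ZMod 1) (_ : ZMod (2 * n + 1)) (_ : Fin 4) => (1 : Matrix.unitaryGroup (Fin 3) ℂ)) m ω₀ ω₁ 0 *
          projM (2 * n + 1) - projP (2 * n + 1)).det‖ + ∑ i, Real.log (max (hL.1.eigenvalues i) 1)) +
      (1 / (2 * n + 1 : ℝ)) * ∑ s : ZMod (2 * n + 1), Real.log ‖(tfreqOpR (fun (σ : ZMod (2 * n)) (x : ZMod (2 * n + 1)) (μ : Fin 4) =>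
        if μ = 3 then (if σ.val % 2 = 0 then A s x 3 else A (s + 1) x 3)
        else if μ = 2 then (if σ.val % 2 = 0 then A s x 2 else (A s x 2)⁻¹) else 1) m ω₀ ω₁).det‖ := by
  have hm1 : -1 < m := by have := (abs_le.mp hm).1; linarith
  exact average_rows n _ _ _ (reflectionChain n (2 * n + 1) A m hm1 ω₀ ω₁ _ (rowPressure_le n A hm ω₀ ω₁ hL) hA)


/-! ### Chain 2: columns -/

/-- Column pressures are at most the free pressure (even slice length), in the form `reflectionChain` wants. -/
theorem colPressure_le (n : ℕ) [NeZero n] {L₁ : ℕ} [NeZero L₁]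
    (B : ZMod L₁ → ZMod (2 * n) → Fin 4 → Matrix.unitaryGroup (Fin 3) ℂ) {m : ℝ} (hm : |m| ≤ 1 / 10) (ω₀ ω₁ : ℝ)
    (h2n : (oneStepR (fun (_ : ZMod 1) (_ : ZMod (2 * n)) (_ : Fin 4) => (1 : Matrix.unitaryGroup (Fin 3) ℂ)) m ω₀ ω₁ 0).PosDef)
    (s : ZMod L₁) (hs : (oneStepR B m ω₀ ω₁ s).PosDef) :
    Real.log ‖(sliceOpR B m ω₀ ω₁ s * projM (2 * n) - projP (2 * n)).det‖ + ∑ i, Real.log (max (hs.1.eigenvalues i) 1) ≤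
      Real.log ‖(sliceOpR (fun (_ : ZMod 1) (_ : ZMod (2 * n)) (_ : Fin 4) => (1 : Matrix.unitaryGroup (Fin 3) ℂ)) m ω₀ ω₁ 0 *
          projM (2 * n) - projP (2 * n)).det‖ + ∑ i, Real.log (max (h2n.1.eigenvalues i) 1) := by
  have hm1 : -1 < m := by have := (abs_le.mp hm).1; linarith
  have h3 : ∀ x, (fun (_ : ZMod 1) (x : ZMod (2 * n)) (μ : Fin 4) => if μ = 3 then B s x 3 else 1) 0 x 3 = B s x 3 :=
    fun x => if_pos rfl
  have hsl := sliceOpR_congr B (fun (_ : ZMod 1) (x : ZMod (2 * n)) (μ : Fin 4) => if μ = 3 then B s x 3 else 1)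
    m ω₀ ω₁ 0 s h3
  have hos := oneStepR_congr B (fun (_ : ZMod 1) (x : ZMod (2 * n)) (μ : Fin 4) => if μ = 3 then B s x 3 else 1)
    m ω₀ ω₁ 0 s h3
  have hr : (oneStepR (fun (_ : ZMod 1) (x : ZMod (2 * n)) (μ : Fin 4) => if μ = 3 then B s x 3 else 1) m ω₀ ω₁ 0).PosDef := by
    rw [hos]; exact hs
  have key := staticPressureEven n (fun x => B s x 3) m hm1 ω₀ ω₁ hr h2n
  rw [hsl, pressure_congr hos hr hs] at key
  exact key

/-- **Chain 2** (one application of Route B along an odd time direction with an EVEN slice, averaged):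
`log ‖det D_B‖ ≤ π_f(2n) + (1/(2n+1)) Σ_x log ‖det D_{pat_x(B)}‖`. -/
theorem chain2 (n : ℕ) [NeZero n] (B : ZMod (2 * n + 1) → ZMod (2 * n) → Fin 4 → Matrix.unitaryGroup (Fin 3) ℂ)
    {m : ℝ} (hm : |m| ≤ 1 / 10) (ω₀ ω₁ : ℝ)
    (h2n : (oneStepR (fun (_ : ZMod 1) (_ : ZMod (2 * n)) (_ : Fin 4) => (1 : Matrix.unitaryGroup (Fin 3) ℂ)) m ω₀ ω₁ 0).PosDef)
    (hB : (tfreqOpR B m ω₀ ω₁).det ≠ 0) :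
    Real.log ‖(tfreqOpR B m ω₀ ω₁).det‖ ≤
      (Real.log ‖(sliceOpR (fun (_ : ZMod 1) (_ : ZMod (2 * n)) (_ : Fin 4) => (1 : Matrix.unitaryGroup (Fin 3) ℂ)) m ω₀ ω₁ 0 *
          projM (2 * n) - projP (2 * n)).det‖ + ∑ i, Real.log (max (h2n.1.eigenvalues i) 1)) +
      (1 / (2 * n + 1 : ℝ)) * ∑ x : ZMod (2 * n + 1), Real.log ‖(tfreqOpR (fun (σ : ZMod (2 * n)) (y : ZMod (2 * n)) (μ : Fin 4) =>
        if μ = 3 then (if σ.val % 2 = 0 then B x y 3 else B (x + 1) y 3)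
        else if μ = 2 then (if σ.val % 2 = 0 then B x y 2 else (B x y 2)⁻¹) else 1) m ω₀ ω₁).det‖ := by
  have hm1 : -1 < m := by have := (abs_le.mp hm).1; linarith
  exact average_rows n _ _ _ (reflectionChain n (2 * n) B m hm1 ω₀ ω₁ _ (colPressure_le n B hm ω₀ ω₁ h2n) hB)

/-- Transposition does not change `‖det‖` (in the time form). -/
theorem norm_det_tfreqOpR_transpose {L₁ L₂ : ℕ} [NeZero L₁] [NeZero L₂]
    (P : ZMod L₁ → ZMod L₂ → Fin 4 → Matrix.unitaryGroup (Fin 3) ℂ) (m ω₀ ω₁ : ℝ) :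
    ‖(tfreqOpR P m ω₀ ω₁).det‖ =
      ‖(tfreqOpR (fun (b : ZMod L₂) (a : ZMod L₁) (μ : Fin 4) => P a b (Equiv.swap (2 : Fin 4) 3 μ)) m ω₀ ω₁).det‖ := by
  rw [det_tfreqOpR, det_tfreqOpR, rectDetTranspose L₁ L₂ P m ω₀ ω₁]

/-- **Cell step**: for a field `B` on `ℤ/(2n+1) × ℤ/2n` whose rows `x, x+1` carry the links of the column pattern of
the plaquette `(s,x)` of `A`, the slab pattern `pat_x(B)` on the `2n × 2n` torus is the gauge-fixed checkerboard of that
plaquette (`cellGaugeFix`), hence bounded by the cell lemma. -/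
theorem cellStep (n : ℕ) [NeZero n] (A : ZMod (2 * n + 1) → ZMod (2 * n + 1) → Fin 4 → Matrix.unitaryGroup (Fin 3) ℂ)
    (m ω₀ ω₁ F δ₀ c₀ C₀ : ℝ)
    (hcell : ∀ P : Matrix.unitaryGroup (Fin 3) ℂ,
      Real.log ‖(freqOpR euclideanGamma (fun (a b : ZMod (2 * n)) (μ : Fin 4) =>
          if μ = 2 ∧ b.val % 2 = 1 then (if a.val % 2 = 0 then P else P⁻¹) else 1) m ω₀ ω₁).det‖ ≤
        F + (n : ℝ) ^ 2 * (if 3 - ((P : Matrix (Fin 3) (Fin 3) ℂ).trace).re < δ₀ then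
          -c₀ * (3 - ((P : Matrix (Fin 3) (Fin 3) ℂ).trace).re) else C₀))
    (s x : ZMod (2 * n + 1)) (B : ZMod (2 * n + 1) → ZMod (2 * n) → Fin 4 → Matrix.unitaryGroup (Fin 3) ℂ)
    (hB3 : ∀ y, B x y 3 = if y.val % 2 = 0 then A s x 2 else (A s x 2)⁻¹)
    (hB3' : ∀ y, B (x + 1) y 3 = if y.val % 2 = 0 then A s (x + 1) 2 else (A s (x + 1) 2)⁻¹)
    (hB2 : ∀ y, B x y 2 = if y.val % 2 = 0 then A s x 3 else A (s + 1) x 3) :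
    Real.log ‖(tfreqOpR (fun (σ : ZMod (2 * n)) (y : ZMod (2 * n)) (μ : Fin 4) =>
        if μ = 3 then (if σ.val % 2 = 0 then B x y 3 else B (x + 1) y 3)
        else if μ = 2 then (if σ.val % 2 = 0 then B x y 2 else (B x y 2)⁻¹) else 1) m ω₀ ω₁).det‖ ≤
      F + (n : ℝ) ^ 2 * (if 3 - (((A s x 2 * A (s + 1) x 3 * (A s (x + 1) 2)⁻¹ * (A s x 3)⁻¹ : Matrix.unitaryGroup (Fin 3) ℂ) :
          Matrix (Fin 3) (Fin 3) ℂ).trace).re < δ₀ then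
        -c₀ * (3 - (((A s x 2 * A (s + 1) x 3 * (A s (x + 1) 2)⁻¹ * (A s x 3)⁻¹ : Matrix.unitaryGroup (Fin 3) ℂ) :
          Matrix (Fin 3) (Fin 3) ℂ).trace).re) else C₀) := by
  have hlinks := freqOpR_congr_links (L₁ := 2 * n) (L₂ := 2 * n)
    (fun (τ σ : ZMod (2 * n)) (μ : Fin 4) =>
        if μ = 3 then
          (if τ.val % 2 = 0 then (if σ.val % 2 = 0 then A s x 2 else (A s x 2)⁻¹)
            else (if σ.val % 2 = 0 then A s (x + 1) 2 else (A s (x + 1) 2)⁻¹))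
        else if μ = 2 then
          (if τ.val % 2 = 0 then (if σ.val % 2 = 0 then A s x 3 else A (s + 1) x 3)
            else (if σ.val % 2 = 0 then A s x 3 else A (s + 1) x 3)⁻¹)
        else 1) m ω₀ ω₁ euclideanGamma
    (fun (σ : ZMod (2 * n)) (y : ZMod (2 * n)) (μ : Fin 4) =>
        if μ = 3 then (if σ.val % 2 = 0 then B x y 3 else B (x + 1) y 3)
        else if μ = 2 then (if σ.val % 2 = 0 then B x y 2 else (B x y 2)⁻¹) else 1)
    (fun t u => by simp only [hB2]; rfl) (fun t u => by simp only [hB3, hB3']; rfl)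
  rw [det_tfreqOpR, hlinks, cellGaugeFix n (2 * n + 1) A s x m ω₀ ω₁]
  exact hcell _

/-! ### Small arithmetic helpers for the assembly -/

/-- Splitting `Σ φ(d)` into the good and the bad plaquettes. -/
theorem sum_ite_split {ι : Type} (T : Finset ι) (d : ι → ℝ) (δ₀ c₀ C₀ : ℝ) :
    ∑ a ∈ T, (if d a < δ₀ then -c₀ * d a else C₀) =
      -c₀ * (∑ a ∈ T.filter (fun a => d a < δ₀), d a) + C₀ * ((T.filter (fun a => δ₀ ≤ d a)).card : ℝ) := by
  rw [← Finset.sum_filter_add_sum_filter_not T (fun a => d a < δ₀)]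
  rw [Finset.sum_ite_of_true (fun a ha => (Finset.mem_filter.mp ha).2),
    Finset.sum_ite_of_false (fun a ha => (Finset.mem_filter.mp ha).2), Finset.mul_sum, Finset.sum_const, nsmul_eq_mul,
    mul_comm (C₀ : ℝ)]
  rw [Finset.filter_congr (q := fun a => δ₀ ≤ d a) fun a _ => (not_lt (a := d a) (b := δ₀))]

/-- `24 (2n+1)³ ≤ 16^n` for `n ≥ 9`. -/
theorem pow_bound : ∀ n : ℕ, 9 ≤ n → 24 * (2 * n + 1) ^ 3 ≤ 16 ^ n := by
  intro n hn
  induction n, hn using Nat.le_induction with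
  | base => norm_num
  | succ k hk ih =>
    have h1 : (2 * (k + 1) + 1) ^ 3 ≤ 16 * (2 * k + 1) ^ 3 := by
      have : 2 * (k + 1) + 1 ≤ 2 * (2 * k + 1) := by omega
      calc (2 * (k + 1) + 1) ^ 3 ≤ (2 * (2 * k + 1)) ^ 3 := Nat.pow_le_pow_left this 3
        _ = 8 * (2 * k + 1) ^ 3 := by ring
        _ ≤ 16 * (2 * k + 1) ^ 3 := by omega
    calc 24 * (2 * (k + 1) + 1) ^ 3 ≤ 24 * (16 * (2 * k + 1) ^ 3) := Nat.mul_le_mul_left _ h1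
      _ = 16 * (24 * (2 * k + 1) ^ 3) := by ring
      _ ≤ 16 * 16 ^ k := Nat.mul_le_mul_left _ ih
      _ = 16 ^ (k + 1) := by ring

/-- The additive slack is at most `1/L²`: `24 L (1/4)^{2n} ≤ 1/L²` for `L = 2n+1`, `n ≥ 9`. -/
theorem slack_le (n : ℕ) (hn : 9 ≤ n) :
    12 * (2 * n : ℝ) * (1 / 4 : ℝ) ^ (2 * n) + 12 * (2 * n + 1 : ℝ) * (1 / 4 : ℝ) ^ (2 * n) ≤ 1 / ((2 * n + 1 : ℕ) : ℝ) ^ 2 := by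
  have hpow : (1 / 4 : ℝ) ^ (2 * n) = 1 / (16 : ℝ) ^ n := by
    rw [pow_mul, show ((1 : ℝ) / 4) ^ 2 = 1 / 16 by norm_num, _root_.one_div_pow]
  rw [hpow]
  have hb : (24 : ℝ) * (2 * n + 1) ^ 3 ≤ (16 : ℝ) ^ n := by exact_mod_cast pow_bound n hn
  have h16 : (0 : ℝ) < (16 : ℝ) ^ n := by positivity
  have hL : (0 : ℝ) < 2 * n + 1 := by positivity
  push_cast
  rw [show 12 * (2 * (n : ℝ)) * (1 / 16 ^ n) + 12 * (2 * n + 1) * (1 / 16 ^ n) = (12 * (2 * n) + 12 * (2 * n + 1)) / 16 ^ n by ring]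
  rw [div_le_div_iff₀ h16 (by positivity)]
  nlinarith

/-- Double averaging identity. -/
theorem double_avg {T : Type} [Fintype T] (P2 F q : ℝ) (Φ : T → T → ℝ) (hT : 0 < Fintype.card T) :
    (1 / (Fintype.card T : ℝ)) * ∑ s, (P2 + (1 / (Fintype.card T : ℝ)) * ∑ x, (F + q * Φ s x)) =
      P2 + F + (q / (Fintype.card T : ℝ) ^ 2) * ∑ s, ∑ x, Φ s x := by
  have hL : (Fintype.card T : ℝ) ≠ 0 := Nat.cast_ne_zero.mpr hT.ne'
  simp only [Finset.sum_add_distrib, Finset.sum_const, Finset.card_univ, nsmul_eq_mul, ← Finset.mul_sum]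
  field_simp
  ring

/-- The final real arithmetic of the assembly. -/
theorem final_arith (X PL P2 F FL d1 d2 invL2 r c₀ C₀ S N : ℝ)
    (hmain : X ≤ PL + (P2 + F + r * (-c₀ * S + C₀ * N))) (hfree : PL + P2 + F ≤ FL + d1 + d2)
    (hslack : d1 + d2 ≤ invL2) (hr1 : 1 / 5 ≤ r) (hr2 : r ≤ 1) (hc₀ : 0 < c₀) (hS0 : 0 ≤ S) (hN0 : 0 ≤ N) :
    X ≤ FL + (invL2 - c₀ / 5 * S + max C₀ 0 * N) := by
  have h1' : r * (C₀ * N) ≤ max C₀ 0 * N := by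
    rcases le_or_gt 0 C₀ with hC0 | hC0
    · rw [max_eq_left hC0]; nlinarith [mul_nonneg hC0 hN0]
    · rw [max_eq_right hC0.le]
      have : C₀ * N ≤ 0 := mul_nonpos_of_nonpos_of_nonneg hC0.le hN0
      nlinarith
  have h2' : r * (-c₀ * S) ≤ -(c₀ / 5) * S := by
    have : 0 ≤ c₀ * S := mul_nonneg hc₀.le hS0
    nlinarith
  have h3 : r * (-c₀ * S + C₀ * N) ≤ -(c₀ / 5) * S + max C₀ 0 * N := by rw [mul_add]; exact add_le_add h2' h1'
  linarith


end HeavyGain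

end Summit.QuantumFields.QCD.Cruxes.CriticalLineDiamagnetism.ChessboardCellGain
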